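import Mathlib
import Summits.PneNP.PneNP.Theorems.ConvexRankGatesLinAlgGateBlindMonotoneLayer
import Summits.PneNP.PneNP.Theorems.ConvexRankGatesLinAlgGateBlindPluckingBound
import Summits.PneNP.PneNP.Theorems.ConvexRankGatesLinAlgGateBlindDenseRegime

/-!
# Route ConvexRankGates, crux `LinAlgGateBlind` (stmt-PneNP-10681): the PROGRAM DOOR — SG at every `c` for term gates with polynomial monotone programs over atom-ORs (supports)

The master form of the transposition door (`Theorems/ConvexRankGatesLinAlgGateBlindTranspositionDoor.lean`):
the single-gate statement of line `dnf-invariant-wide-gates-see-small-cliques` holds, at EVERY size exponent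
`c`, for every term gate `O` — of ANY class — whose Boolean function factors as
`O(x) = f(⌈𝓗₁⌉(x), …, ⌈𝓗_n⌉(x))` through `n ≤ m^a` atom-ORs `⌈𝓗_j⌉` (`𝓗_j ⊆ 𝒱(l)`, any fan-in) and a
map `f` computed by a monotone straight-line program over `{∧₂, ∨₂}` with `≤ m^a` gates (`CktSize`, the
tree's circuit-size predicate of `Literature/Computability/Complexity/CircuitComposition.lean`).

* `exists_inv_gates_inputs` — Razborov's approximation method (Alon–Boppana 1987, Thm. 2.1, lattice
  `K(m,r,l)`, one-sided errors on bare `k`-cliques × `G(m,q)`) along a `{∧₂, ∨₂}`-program over an ARBITRARY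
  input type `ι`, the input `j` being a function `inp j` of the graph that carries the wire invariant with a
  closed family `I j` off an initial event `N₀` (the host `exists_inv_gates` of `…WideApproxHost.lean` is the
  case `ι = KEdge m`, `inp e = x_e`, `I e = inputFamily l e`, `N₀ = ⊥`); cost `|gs|·T` lost `k`-sets and
  `|gs|·Pl` gained mass on top of `Pr[N₀]`;
* `sg_of_cktSize` — hence, feeding the program with atom-ORs (`inv_atomOr`: one pluck each), a term gate
  with such a factorisation has a one-sided small-clique DNF with `#lostPos ≤ L·T`, `gainedNeg ≤ (n + L)·Pl`;
* `sgClause_of_monotoneProgram` — in the line's regime (`stub_denseRegime (a + c + 1)`, `2 m^a ε_{a+c+1} ≤ ε_c`):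
  `∀ a c, ∀ᶠ m`, every such `O` (with `n, L ≤ m^a`) satisfies the `SGAt`-clause at budget `epsOf c m`;
* `sgAt_of_monotonePrograms` — so `SGAt m (P m) (lOf m) (kOf m) (qOf m) (epsOf c m)` eventually, for every
  `c`, for ANY gate class `P` all of whose term gates over `𝒱(lOf m)` factor this way with exponent `a`.

Reading for the crux: the two research stubs `SG_PERM`, `SG_GRANK` (and the split children `SGPerm`,
`SGHallCover`, `SGCancelling`) are EQUIVALENT to their restrictions to term gates of super-polynomial monotone
program complexity over their own atom-ORs — the refuter's reduction (crux workfile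
`Cruxes/LinAlgGateBlind/DrefuteG2SGMonotone.lean`, there modulo stubs and with vendored definitions) as an
unconditional tree theorem in the line's vocabulary. Known residents of that residue: abelian `p`-group PERM
designs (monotone `𝔽_p`-span programs: 3XOR-SAT is one PERM gate on `O(n)` points and needs monotone circuits of
size `2^{n^{Ω(1)}}`, Göös–Kamath–Robere–Sokolov 2019) and König / Hall-cover GRANK gates (bipartite perfect
matching, `m^{Ω(log m)}`, Razborov 1985). Sources: A. A. Razborov (1985); N. Alon, R. B. Boppana,
Combinatorica 7 (1987), Thm. 2.1, §3. No new definitions; nothing is assumed. [folklore]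
-/

-- `Summit.PneNP.PneNP.…` duplicates `PneNP` BY DESIGN (single-problem summit).
set_option linter.dupNamespace false

noncomputable section

namespace Summit.PneNP.PneNP.Theorems

open Finset Filter Literature.Computability.Complexity Razborov GateList
open Summit.PneNP.PneNP.Cruxes.LinAlgGateBlind.DnfInvariantWideGatesSeeSmallCliques

/-! ### The approximation method along a monotone program over arbitrary inputs -/

/-- **Approximating a `{∧₂, ∨₂}`-program over arbitrary inputs** (Alon–Boppana 1987, proof of Thm. 2.1 in
`K(m, r, l)`; the input-generic twin of `exists_inv_gates`). The inputs `j : ι` are Boolean functions `inp j`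
of the graph carrying the wire invariant with closed families `I j` and no lost clique off the event `N₀`;
every wire of a well-formed program `gs` over `{∧₂, ∨₂}` read at the assignment `j ↦ inp j x` then carries
it with `≤ |gs|·T` lost `k`-sets and gained mass `≤ Pr[N₀] + |gs|·Pl`. [folklore] -/
theorem exists_inv_gates_inputs {ι : Type*} (m k r l T : ℕ) (q Pl : ℝ) (hq0 : 0 ≤ q) (hq1 : q ≤ 1)
    (hPl : ∀ A B : Finset (Finset (Fin m)), IsClosedFamily r l A → IsClosedFamily r l B →
      prob q (fun x : KEdge m → Bool => Accepts (closure r l (A ∪ B)) x ∧ ¬ Accepts (A ∪ B) x) ≤ Pl)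
    (hT : ∀ A B : Finset (Finset (Fin m)), IsClosedFamily r l A → IsClosedFamily r l B →
      #(errPos k A B) ≤ T)
    (inp : ι → (KEdge m → Bool) → Bool) (I : ι → Finset (Finset (Fin m)))
    (N₀ : (KEdge m → Bool) → Prop)
    (hinp : ∀ j, IsClosedFamily r l (I j) ∧
      (∀ x : KEdge m → Bool, ¬ N₀ x → Accepts (I j) x → inp j x = true) ∧
      ∀ S : Finset (Fin m), #S = k → inp j (cliqueVec S) = true →
        Accepts (I j) (cliqueVec S) ∨ S ∈ (∅ : Finset (Finset (Fin m)))) :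
    ∀ gs : List (Gate ι), GateList.WF gs → (∀ gt ∈ gs, gt.fn ∈ monotoneBasis) →
      ∃ (ap : ι ⊕ ℕ → Finset (Finset (Fin m))) (BadP : Finset (Finset (Fin m)))
        (BadN : (KEdge m → Bool) → Prop),
        #BadP ≤ gs.length * T ∧ prob q BadN ≤ prob q N₀ + (gs.length : ℝ) * Pl ∧
        (∀ x, N₀ x → BadN x) ∧
        ∀ w : ι ⊕ ℕ, GateList.OutOK gs.length w →
          IsClosedFamily r l (ap w) ∧
          (∀ x : KEdge m → Bool, ¬ BadN x → Accepts (ap w) x →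
            GateList.wireOf (fun j => inp j x) (GateList.vals gs fun j => inp j x) w = true) ∧
          ∀ S : Finset (Fin m), #S = k →
            GateList.wireOf (fun j => inp j (cliqueVec S))
              (GateList.vals gs fun j => inp j (cliqueVec S)) w = true →
            Accepts (ap w) (cliqueVec S) ∨ S ∈ BadP := by
  classical
  intro gs
  induction gs using List.reverseRecOn with
  | nil =>
    intro _ _
    refine ⟨fun w => match w with
      | .inl j => I j
      | .inr _ => ∅, ∅, N₀, by simp, by simp, fun _ h => h, fun w hw => ?_⟩
    rcases w with j | n
    · exact hinp j
    · exact absurd (hw n rfl) (by simp)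
  | append_singleton gs gt ih =>
    intro hwf hB
    obtain ⟨ap, BadP, BadN, hcP, hcN, hN0, hinv⟩ :=
      ih hwf.of_append_left fun g' hg' => hB g' (List.mem_append_left _ hg')
    have hgOK : GateOK gs.length gt := hwf.gateOK_mid (post := [])
    have hgB : gt.fn ∈ monotoneBasis := hB gt (by simp)
    have hlen : (gs ++ [gt]).length = gs.length + 1 := by simp
    -- the value of the new gate (at any assignment)
    have hnew : ∀ u : ι → Bool, wireOf u (vals (gs ++ [gt]) u) (.inr gs.length) =
        gt.op (fun a => wireOf u (vals gs u) (gt.args a)) := fun u => by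
      rw [wireOf_inr, show gs ++ [gt] = gs ++ gt :: [] from rfl, getD_vals_append_cons]
    -- how to assemble the conclusion from an approximator `Fn` of the new gate (value `val`)
    have assemble : ∀ (BadP' : Finset (Finset (Fin m))) (BadN' : (KEdge m → Bool) → Prop)
        (Fn : Finset (Finset (Fin m))) (val : (KEdge m → Bool) → Bool),
        BadP ⊆ BadP' → (∀ x, BadN x → BadN' x) →
        #BadP' ≤ (gs.length + 1) * T →
        prob q BadN' ≤ prob q N₀ + (gs.length + 1) * Pl →
        (IsClosedFamily r l Fn ∧ (∀ x : KEdge m → Bool, ¬ BadN' x → Accepts Fn x → val x = true) ∧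
          ∀ S : Finset (Fin m), #S = k → val (cliqueVec S) = true →
            Accepts Fn (cliqueVec S) ∨ S ∈ BadP') →
        (∀ x, val x = gt.op fun a => wireOf (fun j => inp j x) (vals gs fun j => inp j x) (gt.args a)) →
        ∃ (ap : ι ⊕ ℕ → Finset (Finset (Fin m))) (BadP : Finset (Finset (Fin m)))
          (BadN : (KEdge m → Bool) → Prop),
          #BadP ≤ (gs ++ [gt]).length * T ∧ prob q BadN ≤ prob q N₀ + ((gs ++ [gt]).length : ℝ) * Pl ∧
          (∀ x, N₀ x → BadN x) ∧
          ∀ w : ι ⊕ ℕ, OutOK (gs ++ [gt]).length w →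
            IsClosedFamily r l (ap w) ∧
            (∀ x : KEdge m → Bool, ¬ BadN x → Accepts (ap w) x →
              wireOf (fun j => inp j x) (vals (gs ++ [gt]) fun j => inp j x) w = true) ∧
            ∀ S : Finset (Fin m), #S = k →
              wireOf (fun j => inp j (cliqueVec S)) (vals (gs ++ [gt]) fun j => inp j (cliqueVec S)) w = true →
              Accepts (ap w) (cliqueVec S) ∨ S ∈ BadP := by
      intro BadP' BadN' Fn val hPP' hNN' hcP' hcN' hFn hval
      refine ⟨fun w => if w = .inr gs.length then Fn else ap w, BadP', BadN',
        by rw [hlen]; exact hcP', by rw [hlen]; push_cast; exact hcN', fun x hx => hNN' x (hN0 x hx),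
        fun w hw => ?_⟩
      by_cases hwn : w = .inr gs.length
      · subst hwn
        dsimp only
        rw [if_pos rfl]
        exact inv_mono hFn Subset.rfl (fun _ h => h) fun x => (hval x).trans (hnew _).symm
      · dsimp only
        rw [if_neg hwn]
        have hw' : OutOK gs.length w := fun n hn => by
          have h1 := hw n hn
          have h2 : n ≠ gs.length := fun h => hwn (hn.trans (by rw [h]))
          simp only [List.length_append, List.length_singleton] at h1
          omega
        exact inv_mono (hinv w hw') hPP' hNN' fun x => (wireOf_vals_append gs [gt] _ w hw').symm
    -- accounting
    have accP : ∀ E : Finset (Finset (Fin m)), #E ≤ T → #(BadP ∪ E) ≤ (gs.length + 1) * T := fun E hE =>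
      calc #(BadP ∪ E) ≤ #BadP + #E := card_union_le _ _
        _ ≤ gs.length * T + T := Nat.add_le_add hcP hE
        _ = (gs.length + 1) * T := by ring
    have accN : ∀ E : (KEdge m → Bool) → Prop, prob q E ≤ Pl →
        prob q (fun x => BadN x ∨ E x) ≤ prob q N₀ + (gs.length + 1) * Pl := fun E hE =>
      calc prob q (fun x => BadN x ∨ E x) ≤ prob q BadN + prob q E := prob_or_le hq0 hq1 _ _
        _ ≤ prob q N₀ + gs.length * Pl + Pl := add_le_add hcN hE
        _ = prob q N₀ + (gs.length + 1) * Pl := by ring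
    have hPl0 : 0 ≤ Pl := (prob_nonneg hq0 hq1 _).trans
      (hPl _ _ (isClosedFamily_smallSets r l) (isClosedFamily_smallSets r l))
    have hmonoP : gs.length * T ≤ (gs.length + 1) * T := Nat.mul_le_mul_right _ (Nat.le_succ _)
    have hmonoN : prob q N₀ + (gs.length : ℝ) * Pl ≤ prob q N₀ + (gs.length + 1) * Pl := by nlinarith
    simp only [monotoneBasis, Set.mem_insert_iff, Set.mem_singleton_iff] at hgB
    rcases hgB with hc | hc
    · -- AND gate
      obtain ⟨wu, wv, rfl⟩ := exists_eq_andGate_of_fn_eq hc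
      have hu : OutOK gs.length wu := fun n hn => hgOK (0 : Fin 2) n hn
      have hv : OutOK gs.length wv := fun n hn => hgOK (1 : Fin 2) n hn
      exact assemble _ BadN _ _ subset_union_left (fun _ h => h)
        (accP _ (hT _ _ (hinv wu hu).1 (hinv wv hv).1)) (hcN.trans hmonoN)
        (inv_and (hinv wu hu) (hinv wv hv))
        fun x => (andGate_op wu wv (wireOf (fun j => inp j x) (vals gs fun j => inp j x))).symm
    · -- OR gate
      obtain ⟨wu, wv, rfl⟩ := exists_eq_orGate_of_fn_eq hc
      have hu : OutOK gs.length wu := fun n hn => hgOK (0 : Fin 2) n hn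
      have hv : OutOK gs.length wv := fun n hn => hgOK (1 : Fin 2) n hn
      exact assemble BadP _ _ _ Subset.rfl (fun _ h => Or.inl h) (hcP.trans hmonoP)
        (accN _ (hPl _ _ (hinv wu hu).1 (hinv wv hv).1))
        (inv_or (hinv wu hu) (hinv wv hv))
        fun x => (orGate_op wu wv (wireOf (fun j => inp j x) (vals gs fun j => inp j x))).symm

/-! ### The door with explicit budgets -/

/-- **SG for a term gate with a monotone program over atom-ORs (explicit budgets).** If
`O(x) = f(⌈𝓗_j⌉(x))_j` with `𝓗_j ⊆ 𝒱(l)` (`j : ι`, a finite type) and `f` has a `{∧₂, ∨₂}`-program with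
`≤ L` gates (`CktSize monotoneBasis`), then some `𝒜 ⊆ 𝒱(l)` approximates `O` one-sidedly with
`#lostPos ≤ L·T` and `gainedNeg ≤ (|ι| + L)·Pl` (`inv_atomOr` for the inputs, `exists_inv_gates_inputs` along
the program; `T`, `Pl` = per-step trimming count / plucking mass). [folklore] -/
theorem sg_of_cktSize {ι : Type*} [Fintype ι] (m r l k T L : ℕ) (q Pl : ℝ)
    (hq0 : 0 ≤ q) (hq1 : q ≤ 1)
    (hPl : ∀ 𝒞 : Finset (Finset (Fin m)), 𝒞 ⊆ smallSets (Fin m) l →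
      prob q (fun x : KEdge m → Bool => Accepts (closure r l 𝒞) x ∧ ¬ Accepts 𝒞 x) ≤ Pl)
    (hT : ∀ A B : Finset (Finset (Fin m)), IsClosedFamily r l A → IsClosedFamily r l B →
      #(errPos k A B) ≤ T)
    (𝓗 : ι → Finset (Finset (Fin m))) (h𝓗 : ∀ j, 𝓗 j ⊆ smallSets (Fin m) l)
    (f : (ι → Bool) → Bool) (hf : CktSize monotoneBasis (fun (u : ι → Bool) (_ : Unit) => f u) L)
    (O : (KEdge m → Bool) → Bool) (hO : ∀ x, O x = f fun j => acceptsB (𝓗 j) x) :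
    ∃ 𝒜 ⊆ smallSets (Fin m) l,
      #(lostPos m k O 𝒜) ≤ L * T ∧ gainedNeg m q O 𝒜 ≤ ((Fintype.card ι : ℝ) + L) * Pl := by
  classical
  have hPl0 : 0 ≤ Pl := (prob_nonneg hq0 hq1 _).trans (hPl ∅ (empty_subset _))
  obtain ⟨gs, out, hlen, hR⟩ := hf
  -- the inputs: atom-ORs, one pluck each
  set N₀ : (KEdge m → Bool) → Prop := fun x => ∃ j ∈ (univ : Finset ι),
    Accepts (closure r l (𝓗 j)) x ∧ ¬ Accepts (𝓗 j) x with hN₀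
  have hN₀prob : prob q N₀ ≤ (Fintype.card ι : ℝ) * Pl := by
    calc prob q N₀ ≤ ∑ j ∈ (univ : Finset ι),
          prob q (fun x : KEdge m → Bool => Accepts (closure r l (𝓗 j)) x ∧ ¬ Accepts (𝓗 j) x) :=
          prob_exists_le hq0 hq1 (univ : Finset ι)
            (fun (j : ι) (x : KEdge m → Bool) => Accepts (closure r l (𝓗 j)) x ∧ ¬ Accepts (𝓗 j) x)
      _ ≤ ∑ _j ∈ (univ : Finset ι), Pl := sum_le_sum fun j _ => hPl _ (h𝓗 j)
      _ = (Fintype.card ι : ℝ) * Pl := by rw [sum_const, card_univ, nsmul_eq_mul]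
  have hinp : ∀ j, IsClosedFamily r l (closure r l (𝓗 j)) ∧
      (∀ x : KEdge m → Bool, ¬ N₀ x → Accepts (closure r l (𝓗 j)) x →
        (fun j x => acceptsB (𝓗 j) x) j x = true) ∧
      ∀ S : Finset (Fin m), #S = k → (fun j x => acceptsB (𝓗 j) x) j (cliqueVec S) = true →
        Accepts (closure r l (𝓗 j)) (cliqueVec S) ∨ S ∈ (∅ : Finset (Finset (Fin m))) := fun j =>
    inv_atomOr (h𝓗 j) (fun x => host_acceptsB_eq_true_iff _ _) ∅ fun x hx => ⟨j, mem_univ _, hx⟩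
  obtain ⟨ap, BadP, BadN, hcP, hcN, -, hinv⟩ := exists_inv_gates_inputs m k r l T q Pl hq0 hq1
    (fun A B hA hB => hPl (A ∪ B) (union_subset hA.subset hB.subset)) hT
    (fun j x => acceptsB (𝓗 j) x) (fun j => closure r l (𝓗 j)) N₀ hinp gs hR.wf hR.isOver
  obtain ⟨hFc, hneg, hpos⟩ := hinv (out ()) (hR.outOK ())
  have hev : ∀ x, wireOf (fun j => acceptsB (𝓗 j) x)
      (vals gs fun j => acceptsB (𝓗 j) x) (out ()) = O x := fun x =>
    (hR.eval _ ()).trans (hO x).symm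
  refine ⟨ap (out ()), hFc.subset, ?_, ?_⟩
  · have hsub : lostPos m k O (ap (out ())) ⊆ BadP := fun S hS => by
      simp only [lostPos, mem_filter, mem_powersetCard] at hS
      obtain ⟨⟨-, hSk⟩, hOS, hacc⟩ := hS
      exact (hpos S hSk ((hev _).trans hOS)).resolve_left hacc
    exact (card_le_card hsub).trans (hcP.trans (Nat.mul_le_mul_right _ hlen))
  · calc gainedNeg m q O (ap (out ())) ≤ prob q BadN := by
          refine prob_mono hq0 hq1 fun x hx => ?_
          by_contra hB
          have h1 := (hev x).symm.trans (hneg x hB hx.2)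
          rw [hx.1] at h1
          exact Bool.false_ne_true h1
      _ ≤ prob q N₀ + (gs.length : ℝ) * Pl := hcN
      _ ≤ (Fintype.card ι : ℝ) * Pl + L * Pl := by
          refine add_le_add hN₀prob (mul_le_mul_of_nonneg_right ?_ hPl0)
          exact_mod_cast hlen
      _ = ((Fintype.card ι : ℝ) + L) * Pl := by ring

/-! ### The door in the line's regime: every `c` -/

/-- Budget arithmetic: `2 m^a · ε_{a+c+1}(m) ≤ ε_c(m)` for `m ≥ 2`. [folklore] -/
theorem two_mul_pow_mul_epsOf_add_le {a c m : ℕ} (hm : 2 ≤ m) :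
    2 * (m : ℝ) ^ a * epsOf (a + c + 1) m ≤ epsOf c m := by
  rw [DenseRegime.epsOf_eq, DenseRegime.epsOf_eq]
  have hm' : (2 : ℝ) ≤ m := by exact_mod_cast hm
  have hmpos : (0 : ℝ) < m := by linarith
  have e2 : (m : ℝ) ^ (a + c + 1 + 1) = (m : ℝ) ^ a * (m : ℝ) ^ (c + 1) * m := by
    rw [← pow_add, ← pow_succ]; ring_nf
  rw [e2, mul_one_div, div_le_div_iff₀ (by positivity) (by positivity)]
  have h4 : 0 ≤ (m : ℝ) ^ a * (m : ℝ) ^ (c + 1) := by positivity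
  nlinarith [h4, mul_le_mul_of_nonneg_left hm' h4]

/-- **THE PROGRAM DOOR (all `c`).** For all `a, c`, eventually in `m`: every Boolean function `O` of graphs
that factors as `O(x) = f(⌈𝓗₁⌉(x), …, ⌈𝓗_n⌉(x))` with `n ≤ m^a` atom-ORs `𝓗_j ⊆ 𝒱(lOf m)` and a
`{∧₂, ∨₂}`-program for `f` with `≤ m^a` gates satisfies the single-gate clause of the line at budget
`epsOf c m` (`sg_of_cktSize` with `r = rOf (a+c+1) m`, `stub_pluckingBound`, `card_errPos_le_wide`,
`stub_denseRegime (a+c+1)` and `2 m^a ε_{a+c+1} ≤ ε_c`). [folklore] -/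
theorem sgClause_of_monotoneProgram : ∀ a c : ℕ, ∀ᶠ m : ℕ in atTop, ∀ O : (KEdge m → Bool) → Bool, (∃ (n : ℕ) (𝓗 : Fin n → Finset (Finset (Fin m))) (f : (Fin n → Bool) → Bool), n ≤ m ^ a ∧ (∀ j, 𝓗 j ⊆ smallSets (Fin m) (lOf m)) ∧ CktSize monotoneBasis (fun (u : Fin n → Bool) (_ : Unit) => f u) (m ^ a) ∧ ∀ x, O x = f fun j => acceptsB (𝓗 j) x) → ∃ 𝒜 ⊆ smallSets (Fin m) (lOf m), (#(lostPos m (kOf m) O 𝒜) : ℝ) ≤ epsOf c m * (m.choose (kOf m) : ℝ) ∧ gainedNeg m (qOf m) O 𝒜 ≤ epsOf c m := by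
  intro a c
  filter_upwards [stub_denseRegime (a + c + 1), eventually_ge_atTop 2] with m hR hm2 O hO
  obtain ⟨-, hr, -, hq0, hq1, hpl, hand, -, -, -⟩ := hR
  obtain ⟨n, 𝓗, f, hn, h𝓗, hf, hOf⟩ := hO
  obtain ⟨𝒜, h𝒜, hlost, hgain⟩ := sg_of_cktSize m (rOf (a + c + 1) m) (lOf m) (kOf m)
    (((rOf (a + c + 1) m - 1) ^ lOf m) ^ 2 * (m - (lOf m + 1)).choose (kOf m - (lOf m + 1))) (m ^ a) (qOf m)
    ((#(smallSets (Fin m) (lOf m)) : ℝ) * (1 - qOf m ^ ((lOf m).choose 2)) ^ rOf (a + c + 1) m) hq0 hq1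
    (fun 𝒞 h𝒞 => stub_pluckingBound m _ _ _ hq0 hq1 𝒞 h𝒞) (fun A B hA hB => card_errPos_le_wide hr hA hB)
    𝓗 h𝓗 f hf O hOf
  have hkey := two_mul_pow_mul_epsOf_add_le (a := a) (c := c) hm2
  have hma : ((m ^ a : ℕ) : ℝ) = (m : ℝ) ^ a := by push_cast; ring
  have hPl0 : 0 ≤ (#(smallSets (Fin m) (lOf m)) : ℝ) * (1 - qOf m ^ ((lOf m).choose 2)) ^ rOf (a + c + 1) m :=
    mul_nonneg (Nat.cast_nonneg _) (pow_nonneg (sub_nonneg.2 (pow_le_one₀ hq0 hq1)) _)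
  have hε0 : 0 ≤ epsOf (a + c + 1) m := epsOf_nonneg _ _
  have hn' : (Fintype.card (Fin n) : ℝ) + (m ^ a : ℕ) ≤ 2 * (m : ℝ) ^ a := by
    rw [Fintype.card_fin, hma]
    have : (n : ℝ) ≤ (m : ℝ) ^ a := by rw [← hma]; exact_mod_cast hn
    linarith
  refine ⟨𝒜, h𝒜, ?_, ?_⟩
  · calc (#(lostPos m (kOf m) O 𝒜) : ℝ)
        ≤ ((m ^ a : ℕ) : ℝ) * ((((rOf (a + c + 1) m - 1) ^ lOf m) ^ 2 *
            (m - (lOf m + 1)).choose (kOf m - (lOf m + 1)) : ℕ) : ℝ) := by exact_mod_cast hlost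
      _ ≤ (m : ℝ) ^ a * (epsOf (a + c + 1) m * (m.choose (kOf m) : ℝ)) := by
          rw [hma]; exact mul_le_mul_of_nonneg_left hand (by positivity)
      _ ≤ (2 * (m : ℝ) ^ a * epsOf (a + c + 1) m) * (m.choose (kOf m) : ℝ) := by
          have : 0 ≤ (m : ℝ) ^ a * (epsOf (a + c + 1) m * (m.choose (kOf m) : ℝ)) := by positivity
          nlinarith
      _ ≤ epsOf c m * (m.choose (kOf m) : ℝ) := mul_le_mul_of_nonneg_right hkey (Nat.cast_nonneg _)
  · calc gainedNeg m (qOf m) O 𝒜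
        ≤ ((Fintype.card (Fin n) : ℝ) + (m ^ a : ℕ)) *
            ((#(smallSets (Fin m) (lOf m)) : ℝ) * (1 - qOf m ^ ((lOf m).choose 2)) ^ rOf (a + c + 1) m) := hgain
      _ ≤ (2 * (m : ℝ) ^ a) * epsOf (a + c + 1) m := mul_le_mul hn' hpl hPl0 (by positivity)
      _ ≤ epsOf c m := by linarith

/-- **`SGAt` for any class of programmable term gates (all `c`).** If every term gate of the class `P m`
over `𝒱(lOf m)` factors through `≤ m^a` atom-ORs and a monotone program with `≤ m^a` gates, then
`SGAt m (P m) (lOf m) (kOf m) (qOf m) (epsOf c m)` holds eventually in `m`, for every `c`. [folklore] -/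
theorem sgAt_of_monotonePrograms : ∀ (P : ℕ → GateFn → Prop) (a : ℕ), (∀ m : ℕ, ∀ O : (KEdge m → Bool) → Bool, IsTermGate m (P m) (lOf m) O → ∃ (n : ℕ) (𝓗 : Fin n → Finset (Finset (Fin m))) (f : (Fin n → Bool) → Bool), n ≤ m ^ a ∧ (∀ j, 𝓗 j ⊆ smallSets (Fin m) (lOf m)) ∧ CktSize monotoneBasis (fun (u : Fin n → Bool) (_ : Unit) => f u) (m ^ a) ∧ ∀ x, O x = f fun j => acceptsB (𝓗 j) x) → ∀ c : ℕ, ∀ᶠ m : ℕ in atTop, SGAt m (P m) (lOf m) (kOf m) (qOf m) (epsOf c m) := by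
  intro P a hP c
  filter_upwards [sgClause_of_monotoneProgram a c] with m hm O hO
  exact hm O (hP m O hO)

end Summit.PneNP.PneNP.Theorems

end
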